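import Mathlib
import Summits.NavierStokesRegularity.NavierStokesRegularity.Theorems.TaoLadderRungThreeGappedFrontRobustEnvelope
import HarnessLib

/-!
# `GappedFrontRobust`, the (step) clause: THE ONE-STEP RECURSION OF THE SLACK WEIGHT and the
  supersolution bound (slack weights bounded uniformly in the number of past epochs; helper for item
  stmt-NavierStokesRegularity-22114 `GappedFrontRobustV2`)

HONEST FRAMING: elementary real-number bookkeeping about the cell's slack envelope
`TaoCascade.slackWeight` (Tao 2016 §6.4 Lemma 6.7 / (4.10)); nothing is asserted about any table or flow;
nothing here concerns the Navier–Stokes equations.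

The (step) clause hands the prover an accumulated slack `B₀ ≤ η · slackWeight ε₀ θ c env L k` with an
ARBITRARY number `L` of past epochs, so every budget of the assembly needs a bound of the slack weight that
is uniform in `L`. Writing `q = 1+ε₀`, the slack weight obeys the one-step recursion
`slackWeight (L+1) k = c q^{2k} q^{5/2+θ} env (k+1) + q^{1/2+θ} slackWeight L (k+1)` (`slackWeight_succ`),
so every nonnegative SUPERSOLUTION `B` (`c q^{2k} q^{5/2+θ} env (k+1) + q^{1/2+θ} B (k+1) ≤ B k`) bounds
all slack weights (`slackWeight_le_of_supersolution`). The companion module `…SlackBound` applies this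
to the assembly's two-piece envelope.
-/

noncomputable section

-- the sub-problem namespace `Summit.NavierStokesRegularity.NavierStokesRegularity` repeats the summit name by design (D-0017)
set_option linter.dupNamespace false

namespace Summit.NavierStokesRegularity.NavierStokesRegularity.Theorems

open Set Literature.Analysis.FluidPDE Literature.Analysis.FluidPDE.TaoCascade

namespace GappedFrontRobust

/-! ### The one-step recursion of the slack weight and supersolutions -/

/-- The slack sum re-indexed over `Finset.range`:
`slackWeight L k = c q^{2k} ∑_{i<L} q^{(5/2+θ)(i+1)} env (k+1+i)`.
[cite: Tao2016AveragedNS, §6.4 Lemma 6.7 (cumulative energy bound); cell vocabulary] -/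
theorem slackWeight_eq_sum_range (ε₀ θ c : ℝ) (env : ℤ → ℝ) (L : ℕ) (k : ℤ) :
    slackWeight ε₀ θ c env L k =
      c * (1 + ε₀) ^ ((2 : ℝ) * k) *
        ∑ i ∈ Finset.range L, (1 + ε₀) ^ ((5 / 2 + θ) * ((i : ℝ) + 1)) * env (k + 1 + i) := by
  unfold slackWeight
  congr 1
  rw [Finset.range_eq_Ico]
  have : Finset.Icc 1 L = Finset.Ico (0 + 1) (L + 1) := by
    ext d; simp only [Finset.mem_Icc, Finset.mem_Ico]; omega
  rw [this, ← Finset.sum_Ico_add' (fun d : ℕ => (1 + ε₀) ^ ((5 / 2 + θ) * (d : ℝ)) * env (k + d)) 0 L 1]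
  refine Finset.sum_congr rfl fun i _ => ?_
  push_cast
  rw [show k + ((i : ℤ) + 1) = k + 1 + (i : ℤ) by ring]

/-- **One-step recursion**: `slackWeight (L+1) k = c q^{2k} q^{5/2+θ} env (k+1) + q^{1/2+θ} slackWeight L (k+1)`
(`q = 1+ε₀ > 0`; split off the first past epoch and shift the shell).
[cite: Tao2016AveragedNS, §6.4 Lemma 6.7 (cumulative energy bound); cell vocabulary] -/
theorem slackWeight_succ {ε₀ : ℝ} (hε : 0 < 1 + ε₀) (θ c : ℝ) (env : ℤ → ℝ) (L : ℕ) (k : ℤ) :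
    slackWeight ε₀ θ c env (L + 1) k =
      c * (1 + ε₀) ^ ((2 : ℝ) * k) * ((1 + ε₀) ^ (5 / 2 + θ) * env (k + 1)) +
        (1 + ε₀) ^ (1 / 2 + θ) * slackWeight ε₀ θ c env L (k + 1) := by
  rw [slackWeight_eq_sum_range, slackWeight_eq_sum_range, Finset.sum_range_succ']
  simp only [Nat.cast_zero, zero_add, mul_one, Int.cast_add, Int.cast_one, Nat.cast_add, Nat.cast_one,
    add_zero]
  -- the shifted terms
  have hterm : ∀ i : ℕ, (1 + ε₀) ^ ((5 / 2 + θ) * ((i : ℝ) + 1 + 1)) * env (k + 1 + ((i : ℤ) + 1)) =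
      (1 + ε₀) ^ (5 / 2 + θ) * ((1 + ε₀) ^ ((5 / 2 + θ) * ((i : ℝ) + 1)) * env (k + 1 + 1 + i)) := by
    intro i
    have h1 : (1 + ε₀) ^ ((5 / 2 + θ) * ((i : ℝ) + 1 + 1)) =
        (1 + ε₀) ^ (5 / 2 + θ) * (1 + ε₀) ^ ((5 / 2 + θ) * ((i : ℝ) + 1)) := by
      rw [← Real.rpow_add hε]; ring_nf
    have h2 : k + 1 + ((i : ℤ) + 1) = k + 1 + 1 + i := by ring
    rw [h1, h2]; ring
  have hsum : ∑ i ∈ Finset.range L, (1 + ε₀) ^ ((5 / 2 + θ) * ((i : ℝ) + 1 + 1)) *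
      env (k + 1 + ((i : ℤ) + 1)) =
      (1 + ε₀) ^ (5 / 2 + θ) * ∑ i ∈ Finset.range L,
        (1 + ε₀) ^ ((5 / 2 + θ) * ((i : ℝ) + 1)) * env (k + 1 + 1 + i) := by
    rw [Finset.mul_sum]
    exact Finset.sum_congr rfl fun i _ => hterm i
  rw [hsum]
  -- q^{2k} q^{5/2+θ} = q^{1/2+θ} q^{2(k+1)}
  have hpow : (1 + ε₀) ^ ((2 : ℝ) * k) * (1 + ε₀) ^ (5 / 2 + θ) =
      (1 + ε₀) ^ (1 / 2 + θ) * (1 + ε₀) ^ ((2 : ℝ) * ((k : ℝ) + 1)) := by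
    rw [← Real.rpow_add hε, ← Real.rpow_add hε]; ring_nf
  calc c * (1 + ε₀) ^ ((2 : ℝ) * k) *
        ((1 + ε₀) ^ (5 / 2 + θ) * ∑ i ∈ Finset.range L,
            (1 + ε₀) ^ ((5 / 2 + θ) * ((i : ℝ) + 1)) * env (k + 1 + 1 + i) +
          (1 + ε₀) ^ (5 / 2 + θ) * env (k + 1))
      = c * (1 + ε₀) ^ ((2 : ℝ) * k) * ((1 + ε₀) ^ (5 / 2 + θ) * env (k + 1)) +
          c * ((1 + ε₀) ^ ((2 : ℝ) * k) * (1 + ε₀) ^ (5 / 2 + θ)) *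
            ∑ i ∈ Finset.range L, (1 + ε₀) ^ ((5 / 2 + θ) * ((i : ℝ) + 1)) * env (k + 1 + 1 + i) := by
        ring
    _ = _ := by rw [hpow]; ring

/-- **Supersolutions bound every slack weight.** If `env ≥ 0`, `c ≥ 0`, `q = 1+ε₀ > 0`, and `B ≥ 0`
satisfies `c q^{2k} q^{5/2+θ} env (k+1) + q^{1/2+θ} B (k+1) ≤ B k` for every shell `k`, then
`slackWeight ε₀ θ c env L k ≤ B k` for every `L` and `k` (induction on `L` via `slackWeight_succ`).
[cite: Tao2016AveragedNS, §6.4 Lemma 6.7 (cumulative energy bound); cell vocabulary] -/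
theorem slackWeight_le_of_supersolution {ε₀ θ c : ℝ} {env B : ℤ → ℝ} (hε : 0 < 1 + ε₀)
    (hB0 : ∀ k, 0 ≤ B k)
    (hB : ∀ k : ℤ, c * (1 + ε₀) ^ ((2 : ℝ) * k) * ((1 + ε₀) ^ (5 / 2 + θ) * env (k + 1)) +
      (1 + ε₀) ^ (1 / 2 + θ) * B (k + 1) ≤ B k) :
    ∀ (L : ℕ) (k : ℤ), slackWeight ε₀ θ c env L k ≤ B k := by
  intro L
  induction L with
  | zero =>
    intro k
    have : slackWeight ε₀ θ c env 0 k = 0 := by simp [slackWeight]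
    rw [this]; exact hB0 k
  | succ L ih =>
    intro k
    rw [slackWeight_succ hε]
    have h1 : (1 + ε₀) ^ (1 / 2 + θ) * slackWeight ε₀ θ c env L (k + 1) ≤
        (1 + ε₀) ^ (1 / 2 + θ) * B (k + 1) :=
      mul_le_mul_of_nonneg_left (ih (k + 1)) (Real.rpow_pos_of_pos hε _).le
    linarith [hB k]

end GappedFrontRobust

end Summit.NavierStokesRegularity.NavierStokesRegularity.Theorems

end
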